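import Summits.BirchSwinnertonDyer.BirchSwinnertonDyer.Theorems.Rank2ObservatoryCubicFieldR317372
import HarnessLib

/-!
# BirchSwinnertonDyer — rank ≥ 2 observatory: class number one of the cubic field of `-154 + 297 * X - 34 * X ^ 2 + X ^ 3` (`Δ = 317372`) — certificates at the primes 151, 157

HONEST FRAMING: per-curve certified theorems and census instruments; no claim on BSD in rank ≥ 2.

Companion of the per-FIELD file `Rank2ObservatoryCubicFieldR317372` of the KERNEL-2DESC instrument (design
`b2b-bsdr2-cert-3/KERNEL-2DESC.md` §9e–§9g): the degree-one prime-element certificates at the primes 151, 157 (part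
b). Split off for file size; generated by the same generator from the same checked data.
Sorry-free; axioms `propext`, `Classical.choice`, `Quot.sound`.
[cite: Marcus2018, Ch. 3 Thm. 27, Ch. 5 Cor. 2 of Thm. 37]
-/

-- single-conjunct summit: `Summit.BirchSwinnertonDyer.BirchSwinnertonDyer.…` repeats the name by design
set_option linter.dupNamespace false

noncomputable section

open scoped Classical NumberField

open Literature.NumberTheory.NumberFields Polynomial Module NumberField

namespace Summit.BirchSwinnertonDyer.BirchSwinnertonDyer.Rank2Observatory.TwoDescCubic

namespace FieldR317372

/-! ## Class number one -/

/-- Certificate at `151`: every ring map `ψ : 𝓞 K → ℤ/151` kills a prime element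
(`α ↦ 80`: `-141 + 275 * α - 15 * α ^ 2` (norm `-151`); `α ↦ 123`: `321 + 71 * α - 5 * α ^ 2` (norm `151`); `α ↦ 133`: `-185 + 46 * α - 2 * α ^ 2` (norm `151`)). [cite: Marcus2018, Ch. 3, Thm. 27] -/
theorem cert151 (ψ : 𝓞 (CubicField (-34) 297 (-154)) →+* ZMod 151) : ∃ e : 𝓞 (CubicField (-34) 297 (-154)), ψ e = 0 ∧ Prime e := by
  refine cert_of_cases aeval_α ψ (fun t ht hF => ?_)
  have hroots : ∀ t : ZMod 151,
      t ^ 3 + (((-34) : ℤ) : ZMod 151) * t ^ 2 + ((297 : ℤ) : ZMod 151) * t + (((-154) : ℤ) : ZMod 151) = 0 → t = 80 ∨ t = 123 ∨ t = 133 := by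
    decide +kernel
  rcases hroots t hF with rfl | rfl | rfl
  · exact ⟨lin aeval_α (-141) 275 (-15), by simp only [lin, map_add, map_mul, map_pow, map_intCast, ht]; decide,
      lin_prime_of_prime irreducible aeval_α finrank_eq (-141) 275 (-15) (n := (-151))
        (by norm_num [MonicCubic.normForm]) (by norm_num)⟩
  · exact ⟨lin aeval_α 321 71 (-5), by simp only [lin, map_add, map_mul, map_pow, map_intCast, ht]; decide,
      lin_prime_of_prime irreducible aeval_α finrank_eq 321 71 (-5) (n := 151)
        (by norm_num [MonicCubic.normForm]) (by norm_num)⟩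
  · exact ⟨lin aeval_α (-185) 46 (-2), by simp only [lin, map_add, map_mul, map_pow, map_intCast, ht]; decide,
      lin_prime_of_prime irreducible aeval_α finrank_eq (-185) 46 (-2) (n := 151)
        (by norm_num [MonicCubic.normForm]) (by norm_num)⟩

/-- Certificate at `157`: `g` has no root mod `157`, so there is no ring map `𝓞 K → ℤ/157`. [folklore] -/
theorem cert157 (ψ : 𝓞 (CubicField (-34) 297 (-154)) →+* ZMod 157) : ∃ e : 𝓞 (CubicField (-34) 297 (-154)), ψ e = 0 ∧ Prime e :=
  cert_of_no_root aeval_α ψ (by decide +kernel)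

end FieldR317372

end Summit.BirchSwinnertonDyer.BirchSwinnertonDyer.Rank2Observatory.TwoDescCubic

end
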